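import Summits.PneNP.PneNP.Theorems.ChebyshevTracialDesignGlobalMisalignment
import Summits.PneNP.PneNP.Theorems.ChebyshevTracialDesignDictionary
import HarnessLib

/-!
# Cell pnp-psdrank, route `ChebyshevTracialDesign`: DIRECTIONAL MIXING — a direction fixed by a μ-fraction of the cut operators carries average
# matching weight at most 1/(μ·n) (crux `TracialDecayExp20`, stmt-PneNP-19878)

Brick 41 (prover g9). A one-parameter family of constraints on tight-orthogonal psd rectangles `(X, Y)` of ANY dimension `r`, read off brick 36
(`…GlobalMisalignment.trace_sum_mul_sum_le`) in dimension one. Fix a vector `v ∈ ℝ^r` and a family `𝒜` of `t`-cuts (`t = 2c'+1 ≤ n/2`) whose operators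
FIX `v` (`X_U v = v`; for projections: `v ∈ A_U`). Tightness makes the scalar pair (`1_𝒜(U)`, `y_v(M) = vᵀ Y_M v`) tight-free — `X_U Y_M = 0 ⇒ Y_M v = Y_M X_U v = 0`
(`quadForm_eq_zero_of_tight`) — so the Hilbert–Schmidt mixing inequality in dimension `1` gives

  `|𝒜| · Σ_M vᵀY_Mv ≤ √(C(n,t)·|PM_n|/n · |𝒜| · Σ_M (vᵀY_Mv)²)`                    (`directional_mixing`),

and, since `0 ≤ vᵀY_Mv ≤ ‖v‖²` for contractions, in density form  `μ_𝒜 · ȳ_v ≤ ‖v‖²/n`  with `μ_𝒜 = |𝒜|/C(n,t)`, `ȳ_v = E_M vᵀY_Mv`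
(`density_mul_avgWeight_le`): a direction shared (fixed) by a `μ`-fraction of the cut operators is used by the matching side with average weight `≤ 1/(μn)`.
This is the quantitative reason dictionary-heavy cut sides lose (brick 34) and the first constraint a 'directional Kupavskii–Zakharov' step meets: heavy
shared directions on one side are nearly EMPTY directions on the other. [cite: BrouwerHaemers2012, Prop. 4.3.2 (PDF p. 83)] [cite: GodsilMeagher2015, §15.2]
[cite: Rothvoss2017, §2 (PDF p. 6)]
Stature: support/instrument. WHAT THIS IS NOT: no bound on the design value, nothing on psd rank of P_PM, no P-vs-NP content.
-/

set_option linter.dupNamespace false -- `Summit.PneNP.PneNP.…`: summit = sub-problem (D-0017)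

noncomputable section

namespace Summit.PneNP.PneNP.Theorems.ChebyshevTracialDesignDirectionalMixing

open scoped Classical

open Finset Matrix Literature.Barriers.PneNP Literature.Combinatorics.Optimization
open Summit.PneNP.PneNP.Theorems.ChebyshevTracialDesignGlobalMisalignment (trace_sum_mul_sum_le)
open Summit.PneNP.PneNP.Theorems.ChebyshevTracialDesignDictionary (quadForm_nonneg quadForm_le_self)
open Summit.PneNP.PneNP.Theorems.ChebyshevTracialDesignRungCells (card_tcuts_eq_choose)
open Summit.PneNP.PneNP.Theorems.ChebyshevTracialDesignProfilePolynomial (card_pmatch_pos)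

variable {n : ℕ}

/-! ### §1 Tightness kills the weight of a fixed direction -/

/-- If `X Y = 0` with `X`, `Y` real symmetric and `X v = v`, then `Y v = 0`, hence `vᵀ Y v = 0`. -/
theorem quadForm_eq_zero_of_tight {r : ℕ} {X Y : Matrix (Fin r) (Fin r) ℝ} (hX : X.IsHermitian) (hY : Y.IsHermitian) (h : X * Y = 0)
    {v : Fin r → ℝ} (hv : X *ᵥ v = v) : v ⬝ᵥ (Y *ᵥ v) = 0 := by
  have hXt : Xᵀ = X := by have e := hX.eq; rwa [conjTranspose_eq_transpose_of_trivial] at e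
  have hYt : Yᵀ = Y := by have e := hY.eq; rwa [conjTranspose_eq_transpose_of_trivial] at e
  have hYX : Y * X = 0 := by
    have := congrArg transpose h
    rwa [transpose_mul, hXt, hYt, transpose_zero] at this
  have hYv : Y *ᵥ v = 0 := by
    calc Y *ᵥ v = Y *ᵥ (X *ᵥ v) := by rw [hv]
      _ = (Y * X) *ᵥ v := (mulVec_mulVec _ _ _)
      _ = 0 := by rw [hYX, zero_mulVec]
  rw [hYv, dotProduct_zero]

/-! ### §2 Directional mixing -/

/-- **Directional mixing.** `n` even, `t = 2c'+1 ≤ n/2`, `(X, Y)` a tight-orthogonal psd rectangle of dimension `r`, `v ∈ ℝ^r`, and `𝒜` a family of `t`-cuts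
whose operators fix `v` (`X_U v = v`). Then `|𝒜| · Σ_M vᵀY_Mv ≤ √(C(n,t)·|PM_n|/n · |𝒜| · Σ_M (vᵀY_Mv)²)`.
[cite: BrouwerHaemers2012, Prop. 4.3.2 (PDF p. 83)] [cite: Rothvoss2017, §2 (PDF p. 6)] -/
theorem directional_mixing {r c' : ℕ} (hn : Even n) (ht : 2 * (2 * c' + 1) ≤ n)
    {X : OddSet n → Matrix (Fin r) (Fin r) ℝ} {Y : PMatch n → Matrix (Fin r) (Fin r) ℝ} (hXY : IsPsdRect X Y) (v : Fin r → ℝ)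
    (𝒜 : Finset (OddSet n)) (h𝒜 : ∀ U ∈ 𝒜, U.1.card = 2 * c' + 1 ∧ X U *ᵥ v = v) :
    (𝒜.card : ℝ) * ∑ M, v ⬝ᵥ (Y M *ᵥ v) ≤
      Real.sqrt ((n.choose (2 * c' + 1) : ℝ) * (Fintype.card (PMatch n) : ℝ) / n * ((𝒜.card : ℝ) * ∑ M, (v ⬝ᵥ (Y M *ᵥ v)) ^ 2)) := by
  -- the dimension-one pair (`1_𝒜`, `vᵀ Y v`)
  set X' : OddSet n → Matrix (Fin 1) (Fin 1) ℝ := fun U => (if U ∈ 𝒜 then (1 : ℝ) else 0) • (1 : Matrix (Fin 1) (Fin 1) ℝ) with hX'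
  set Y' : PMatch n → Matrix (Fin 1) (Fin 1) ℝ := fun M => (v ⬝ᵥ (Y M *ᵥ v)) • (1 : Matrix (Fin 1) (Fin 1) ℝ) with hY'
  have htr : ∀ U M, (X' U * Y' M).trace = (if U ∈ 𝒜 then (1 : ℝ) else 0) * (v ⬝ᵥ (Y M *ᵥ v)) := fun U M => by
    rw [hX', hY']; dsimp only
    rw [smul_mul_smul_comm, Matrix.one_mul, trace_smul, trace_one, Fintype.card_fin, Nat.cast_one, smul_eq_mul, mul_one]
  have htight : ∀ (U : OddSet n) (M : PMatch n), U.1.card = 2 * c' + 1 → cc U M = 1 → (X' U * Y' M).trace = 0 := by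
    intro U M _ hUM
    rw [htr]
    by_cases hU : U ∈ 𝒜
    · rw [if_pos hU, one_mul]
      exact quadForm_eq_zero_of_tight (hXY.1 U).1.1 (hXY.2.1 M).1.1 (hXY.2.2 U M hUM) (h𝒜 U hU).2
    · rw [if_neg hU, zero_mul]
  have h := trace_sum_mul_sum_le hn ht X' Y' htight
  -- evaluate both sides
  have h𝒜T : (univ.filter (fun U : OddSet n => U.1.card = 2 * c' + 1)).filter (fun U => U ∈ 𝒜) = 𝒜 := by
    ext U; simp only [mem_filter, mem_univ, true_and]; exact ⟨fun h => h.2, fun h => ⟨(h𝒜 U h).1, h⟩⟩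
  have hSX : ∑ U ∈ univ.filter (fun U : OddSet n => U.1.card = 2 * c' + 1), X' U = (𝒜.card : ℝ) • (1 : Matrix (Fin 1) (Fin 1) ℝ) := by
    rw [hX']; dsimp only
    rw [← sum_smul, ← sum_filter, h𝒜T, sum_const, nsmul_eq_mul, mul_one]
  have hSY : ∑ M, Y' M = (∑ M, v ⬝ᵥ (Y M *ᵥ v)) • (1 : Matrix (Fin 1) (Fin 1) ℝ) := by
    rw [hY']; dsimp only; rw [← sum_smul]
  have hlhs : ((∑ U ∈ univ.filter (fun U : OddSet n => U.1.card = 2 * c' + 1), X' U) * ∑ M, Y' M).trace =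
      (𝒜.card : ℝ) * ∑ M, v ⬝ᵥ (Y M *ᵥ v) := by
    rw [hSX, hSY, smul_mul_smul_comm, Matrix.one_mul, trace_smul, trace_one, Fintype.card_fin, Nat.cast_one, smul_eq_mul, mul_one]
  have hX2 : ∑ U ∈ univ.filter (fun U : OddSet n => U.1.card = 2 * c' + 1), ∑ p, ∑ q, X' U p q ^ 2 = (𝒜.card : ℝ) := by
    have e : ∀ U : OddSet n, ∑ p, ∑ q, X' U p q ^ 2 = if U ∈ 𝒜 then (1 : ℝ) else 0 := fun U => by
      rw [hX']; dsimp only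
      simp only [Fin.sum_univ_one, Matrix.smul_apply, one_apply_eq, smul_eq_mul, mul_one]
      split_ifs <;> norm_num
    rw [sum_congr rfl (fun U _ => e U), ← sum_filter, h𝒜T, sum_const, nsmul_eq_mul, mul_one]
  have hY2 : ∑ M, ∑ p, ∑ q, Y' M p q ^ 2 = ∑ M, (v ⬝ᵥ (Y M *ᵥ v)) ^ 2 := by
    refine sum_congr rfl fun M _ => ?_
    rw [hY']; dsimp only
    simp only [Fin.sum_univ_one, Matrix.smul_apply, one_apply_eq, smul_eq_mul, mul_one]
  rw [hlhs, hX2, hY2] at h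
  exact h

/-- **Density form.** In the setting of `directional_mixing` (any dimension `r`): `μ_𝒜 · ȳ_v ≤ ‖v‖²/n`, where `μ_𝒜 = |𝒜|/C(n,t)` and
`ȳ_v = (Σ_M vᵀY_Mv)/|PM_n|`; for a unit vector: a direction fixed by a `μ`-fraction of the cut operators has average matching weight `≤ 1/(μ n)`.
[cite: GodsilMeagher2015, §15.2] [cite: Rothvoss2017, §2 (PDF p. 6)] -/
theorem density_mul_avgWeight_le {r c' : ℕ} (hn : Even n) (ht : 2 * (2 * c' + 1) ≤ n)
    {X : OddSet n → Matrix (Fin r) (Fin r) ℝ} {Y : PMatch n → Matrix (Fin r) (Fin r) ℝ} (hXY : IsPsdRect X Y) (v : Fin r → ℝ)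
    (𝒜 : Finset (OddSet n)) (h𝒜 : ∀ U ∈ 𝒜, U.1.card = 2 * c' + 1 ∧ X U *ᵥ v = v) :
    ((𝒜.card : ℝ) / (n.choose (2 * c' + 1) : ℝ)) * ((∑ M, v ⬝ᵥ (Y M *ᵥ v)) / (Fintype.card (PMatch n) : ℝ)) ≤ (v ⬝ᵥ v) / n := by
  have h := directional_mixing hn ht hXY v 𝒜 h𝒜
  set Cn : ℝ := (n.choose (2 * c' + 1) : ℝ) with hCn
  set PM : ℝ := (Fintype.card (PMatch n) : ℝ) with hPM
  set a : ℝ := (𝒜.card : ℝ) with ha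
  set S : ℝ := ∑ M, v ⬝ᵥ (Y M *ᵥ v) with hS
  have hCpos : 0 < Cn := by rw [hCn]; exact_mod_cast Nat.choose_pos (by omega)
  have hPMpos : 0 < PM := by rw [hPM]; exact_mod_cast card_pmatch_pos hn
  have hn' : (0 : ℝ) < n := by exact_mod_cast (show 0 < n by omega)
  have ha0 : 0 ≤ a := Nat.cast_nonneg _
  have hq : ∀ M, 0 ≤ v ⬝ᵥ (Y M *ᵥ v) ∧ v ⬝ᵥ (Y M *ᵥ v) ≤ v ⬝ᵥ v := fun M =>
    ⟨quadForm_nonneg (hXY.2.1 M).1 v, quadForm_le_self (hXY.2.1 M).2 v⟩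
  have hS0 : 0 ≤ S := sum_nonneg fun M _ => (hq M).1
  have hvv : 0 ≤ v ⬝ᵥ v := sum_nonneg fun i _ => mul_self_nonneg _
  -- `Σ (vᵀYv)² ≤ ‖v‖² · Σ vᵀYv`
  have hsq : ∑ M, (v ⬝ᵥ (Y M *ᵥ v)) ^ 2 ≤ (v ⬝ᵥ v) * S := by
    rw [hS, mul_sum]
    exact sum_le_sum fun M _ => by rw [sq]; exact mul_le_mul_of_nonneg_right (hq M).2 (hq M).1
  -- square the mixing inequality
  have h2 : (a * S) ^ 2 ≤ Cn * PM / n * (a * ((v ⬝ᵥ v) * S)) := by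
    have hle := h.trans (Real.sqrt_le_sqrt (mul_le_mul_of_nonneg_left (mul_le_mul_of_nonneg_left hsq ha0) (by positivity)))
    exact (Real.le_sqrt (mul_nonneg ha0 hS0) (by positivity)).1 hle
  -- conclude `a S /(Cn PM) ≤ v·v/n`
  rw [div_mul_div_comm, div_le_div_iff₀ (by positivity) hn']
  by_cases hs : a * S = 0
  · rw [hs, zero_mul]; positivity
  · have hpos : 0 < a * S := lt_of_le_of_ne (mul_nonneg ha0 hS0) (Ne.symm hs)
    have h3 : a * S * (a * S) ≤ a * S * (Cn * PM / n * (v ⬝ᵥ v)) := by nlinarith [h2]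
    have h4 : a * S ≤ Cn * PM / n * (v ⬝ᵥ v) := le_of_mul_le_mul_left h3 hpos
    calc a * S * n ≤ Cn * PM / n * (v ⬝ᵥ v) * n := mul_le_mul_of_nonneg_right h4 hn'.le
      _ = v ⬝ᵥ v * (Cn * PM) := by field_simp

end Summit.PneNP.PneNP.Theorems.ChebyshevTracialDesignDirectionalMixing

end
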